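import Mathlib.LinearAlgebra.Dual.Lemmas
import Mathlib.RingTheory.Ideal.Height
import Mathlib.RingTheory.Localization.FractionRing
import Mathlib.RingTheory.LocalRing.Basic
import Literature.RingTheory.IntegralClosure.KrullIntersection
import HarnessLib

/-!
# A reflexive module is determined by its localisations at height-one primes
# (input (B1)(ii) «H⁰ = M» of the G-layer of chain W4.4)

`[OURS · L W4.4]` Crux `HomologicalConductor.NoZenoR` (stmt-ResolutionOfSingularities-19943; twin
`NoZeno` stmt-ResolutionOfSingularities-16483), line `sandwich-cluster`, S3 Layer 2 = THEOREM A at sky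
points (`stub_skyPrincipal`), G-layer item **G2 (full-sheaf package), clause (ii) `H⁰(X, M̃) = M`**
(res-L0-w44-plan-1 CRUX-PLAN v6 §B; res-L0-w44-idea-1 THEOREM Q-rat §3 (B1): «`H⁰(ℳ) ⊆ H⁰(X ∖ E, ℳ) =
H⁰(Spec T ∖ 𝔪, M̃) = M` (M reflexive over the normal T)»).  The scheme-free content of that step is
Serre's remark that a REFLEXIVE module over a noetherian NORMAL domain is the intersection of its
localisations at the height-one primes.  This file proves exactly the membership form the G-layer
consumes, for a reflexive `T`-submodule `M` of any torsion-free `T`-module `V` (in the G-layer: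
`V = K^r`, `K` the function field; the sections of the full sheaf over the punctured neighbourhood are
the vectors lying in `M_𝔭` for every non-maximal prime `𝔭`):

* `mem_of_isReflexive_of_forall_height_eq_one` — if `s₀ • v ∈ M` for some `s₀ ≠ 0` and, for every
  height-one prime `P`, `s • v ∈ M` for some `s ∉ P`, then `v ∈ M`;
* `mem_of_isReflexive_of_forall_ne_maximalIdeal` — the punctured-spectrum form over a normal
  noetherian LOCAL domain of Krull dimension `≥ 2`: if `s • v ∈ M` with `s ∉ 𝔭` for every prime
  `𝔭 ≠ 𝔪`, then `v ∈ M`.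

Proof (no primary decomposition, no `(S₂)`): for `φ ∈ M*` the fraction `φ(s₀ v)/s₀` lies in `T_P`
for every height-one `P`, hence in `T` (Krull, Matsumura Thm. 11.5 (ii) — tree
`Literature.RingTheory.IntegralClosure.exists_algebraMap_eq_of_forall_height_eq_one`); this defines
`ψ ∈ M**`, which by reflexivity is evaluation at some `m₀ ∈ M`, and `s₀ • (v - m₀)` is killed by every
functional, hence zero (a reflexive module is torsionless), hence `v = m₀`.
Replaces the role of no printed item of the manuscript under review (Hironaka 2017); textbook
commutative algebra; AI-written, weaker than expert review.
[cite: Matsumura1987, Thm. 11.5 (ii)]; [cite: BrunsHerzog1998, Prop. 1.4.1]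
-/

-- single-problem summit: the doubled namespace component `ResolutionOfSingularities` is forced
set_option linter.dupNamespace false

noncomputable section

open Module IsLocalRing

universe u v

namespace Summit.ResolutionOfSingularities.ResolutionOfSingularities.Theorems.NoZeno.SandwichCluster

variable {T : Type u} [CommRing T] [IsDomain T] [IsNoetherianRing T] [IsIntegrallyClosed T]
variable {V : Type v} [AddCommGroup V] [Module T V] [NoZeroSMulDivisors T V]

/-- **A reflexive module is the intersection of its localisations at the height-one primes**
(membership form).  `T` a noetherian normal domain, `V` a torsion-free `T`-module, `M ⊆ V` a
submodule which is REFLEXIVE as a `T`-module (`Module.IsReflexive`).  If `v ∈ V` has `s₀ • v ∈ M` for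
some `s₀ ≠ 0` (i.e. `v ∈ K·M`) and for every height-one prime `P` of `T` there is `s ∉ P` with
`s • v ∈ M` (i.e. `v ∈ M_P`), then `v ∈ M`. [cite: Matsumura1987, Thm. 11.5 (ii)];
[cite: BrunsHerzog1998, Prop. 1.4.1] -/
theorem mem_of_isReflexive_of_forall_height_eq_one (M : Submodule T V) [Module.IsReflexive T M]
    {v : V} {s₀ : T} (hs₀ : s₀ ≠ 0) (hv₀ : s₀ • v ∈ M)
    (h : ∀ P : Ideal T, P.IsPrime → P.height = 1 → ∃ s ∉ P, s • v ∈ M) : v ∈ M := by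
  classical
  let K := FractionRing T
  have hinj : Function.Injective (algebraMap T K) := IsFractionRing.injective T K
  have hs₀K : algebraMap T K s₀ ≠ 0 := IsFractionRing.to_map_eq_zero_iff.not.mpr hs₀
  let m₁ : M := ⟨s₀ • v, hv₀⟩
  -- for every functional `φ` on `M`, `φ(s₀ v) / s₀ ∈ T`
  have key : ∀ φ : Module.Dual T M, ∃ t : T, φ m₁ = s₀ * t := by
    intro φ
    obtain ⟨t, ht⟩ := Literature.RingTheory.IntegralClosure.exists_algebraMap_eq_of_forall_height_eq_one
      (R := T) (K := K) (algebraMap T K (φ m₁) / algebraMap T K s₀) (fun P hP hP1 => by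
        obtain ⟨s, hsP, hsv⟩ := h P hP hP1
        refine ⟨s, hsP, φ ⟨s • v, hsv⟩, ?_⟩
        rw [mul_div_assoc', div_eq_iff hs₀K, ← map_mul, ← map_mul]
        congr 1
        -- `s * φ (s₀ v) = φ (s₀ v... ) : both equal φ (s s₀ v)`
        have h1 : s • m₁ = s₀ • (⟨s • v, hsv⟩ : M) := by
          apply Subtype.ext
          change s • (s₀ • v) = s₀ • (s • v)
          rw [smul_smul, smul_smul, mul_comm]
        calc s * φ m₁ = φ (s • m₁) := by rw [map_smul, smul_eq_mul]
          _ = φ (s₀ • ⟨s • v, hsv⟩) := by rw [h1]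
          _ = φ ⟨s • v, hsv⟩ * s₀ := by rw [map_smul, smul_eq_mul, mul_comm])
    refine ⟨t, hinj ?_⟩
    rw [map_mul, ht, mul_div_cancel₀ _ hs₀K]
  choose ψf hψf using key
  -- `ψ : M* → T`, `φ ↦ φ(s₀ v)/s₀`, is linear
  have hψ_unique : ∀ (φ : Module.Dual T M) (t : T), φ m₁ = s₀ * t → t = ψf φ := by
    intro φ t ht
    exact mul_left_cancel₀ hs₀ (ht.symm.trans (hψf φ))
  let ψ : Module.Dual T (Module.Dual T M) :=
    { toFun := ψf
      map_add' := fun φ φ' => by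
        symm
        apply hψ_unique
        rw [LinearMap.add_apply, hψf φ, hψf φ', mul_add]
      map_smul' := fun a φ => by
        symm
        apply hψ_unique
        rw [LinearMap.smul_apply, hψf φ, smul_eq_mul, RingHom.id_apply, smul_eq_mul]
        ring }
  -- by reflexivity `ψ = eval m₀`
  let m₀ : M := (Module.evalEquiv T M).symm ψ
  have hm₀ : ∀ φ : Module.Dual T M, φ m₀ = ψf φ := fun φ =>
    Module.apply_evalEquiv_symm_apply (R := T) (M := M) φ ψ
  -- every functional kills `s₀ v - s₀ m₀`, so it is zero (`M` is torsionless)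
  have hzero : m₁ - s₀ • m₀ = 0 := by
    apply (Module.bijective_dual_eval T M).1
    rw [map_zero]
    ext φ
    rw [Module.Dual.eval_apply, LinearMap.zero_apply, map_sub, map_smul, hm₀ φ, smul_eq_mul,
      hψf φ, sub_self]
  have hV : s₀ • v = s₀ • (m₀ : V) := by
    have := congrArg (fun m : M => (m : V)) hzero
    simpa [m₁, sub_eq_zero] using this
  have : v = (m₀ : V) := smul_right_injective V hs₀ hV
  rw [this]
  exact m₀.2

/-- **Sections over the punctured spectrum**: `T` a noetherian normal LOCAL domain of Krull dimension
`≥ 2`, `V` a torsion-free `T`-module, `M ⊆ V` a reflexive submodule.  If for every prime `𝔭 ≠ 𝔪` there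
is `s ∉ 𝔭` with `s • v ∈ M` (`v` is a section of `M̃` over `Spec T ∖ {𝔪}`), then `v ∈ M` — the form
in which THEOREM Q-rat (B1) uses it: `H⁰(Spec T ∖ 𝔪, M̃) = M` for reflexive `M` over a two-dimensional
normal local domain. [cite: Matsumura1987, Thm. 11.5 (ii)]; [cite: BrunsHerzog1998, Prop. 1.4.1] -/
theorem mem_of_isReflexive_of_forall_ne_maximalIdeal [IsLocalRing T] (hT : 2 ≤ ringKrullDim T)
    (M : Submodule T V) [Module.IsReflexive T M] {v : V}
    (h : ∀ P : Ideal T, P.IsPrime → P ≠ maximalIdeal T → ∃ s ∉ P, s • v ∈ M) : v ∈ M := by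
  have hm : (maximalIdeal T).height = ringKrullDim T := maximalIdeal_height_eq_ringKrullDim
  -- `⊥ ≠ 𝔪` (dimension ≥ 2 > 0) gives `s₀ ≠ 0` with `s₀ • v ∈ M`
  have hbot : (⊥ : Ideal T) ≠ maximalIdeal T := by
    intro hb
    have h0 : ((⊥ : Ideal T).height : WithBot ℕ∞) = ringKrullDim T := by rw [hb, hm]
    rw [Ideal.height_bot] at h0
    have : (2 : WithBot ℕ∞) ≤ ((0 : ℕ∞) : WithBot ℕ∞) := by rw [h0]; exact hT
    exact absurd this (by decide)
  obtain ⟨s₀, hs₀, hv₀⟩ := h ⊥ Ideal.isPrime_bot hbot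
  rw [Submodule.mem_bot] at hs₀
  refine mem_of_isReflexive_of_forall_height_eq_one M hs₀ hv₀ fun P hP hP1 => h P hP ?_
  -- a height-one prime is not `𝔪` (height `𝔪 = dim T ≥ 2`)
  rintro rfl
  have h1 : ((1 : ℕ∞) : WithBot ℕ∞) = ringKrullDim T := by rw [← hP1, hm]
  have : (2 : WithBot ℕ∞) ≤ ((1 : ℕ∞) : WithBot ℕ∞) := by rw [h1]; exact hT
  exact absurd this (by decide)

end Summit.ResolutionOfSingularities.ResolutionOfSingularities.Theorems.NoZeno.SandwichCluster

end
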